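import Mathlib
import HarnessLib
import Literature.NumberTheory.LFunctions.RHWave0
import Literature.NumberTheory.LFunctions.LiouvilleOneSided
import Literature.NumberTheory.LFunctions.KloostermanFractionsAmplifier

/-!
# `TypeIILiouville` (crux stmt-Parity-13322, route `LiouvilleMAD`), line `Sketch`: Stub C

Assembly step of the negative line `Sketch`. Inputs (received as hypotheses, they are the
conclusions of Stubs A and V of the line):

* `hA` — a power saving `|Q_N(y)| ≤ C₁ y N^{-δ₁}` (`N ≥ 2`, `y ≥ N²`) for the prime-progression sums
  `Q_N(y) = ∑_{N < p ≤ 2N, p prime} ∑_{1 ≤ k ≤ y, p ∣ k+1} λ(k)`;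
* `hV` — for some `0 < θ ≤ 1/4`, `δ₂ > 0`: the remainder
  `R_N(y) = ∑_{N < p ≤ 2N} (∑_{k ≤ y, p ∣ k+1} λ(k) − (L(y) + L(⌊y/p⌋))/(p − 1))` is at most
  `C₂ y^{1−δ₂}` whenever `y^θ/2 ≤ N ≤ y^θ` and `y ≥ y₀`.

Output (`stub_C`): a power saving for the summatory Liouville function `L(x) = ∑_{n ≤ x} λ(n)`,
`|L(x)| ≤ C x^{1−δ}` for `x ≥ x₀`, some `0 < δ < 1/2`.

Mechanism. Summing the summands of `R_N(y)` over `p` gives the identity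
`(∑_p 1/(p−1)) · L(y) = Q_N(y) − R_N(y) − ∑_p L(⌊y/p⌋)/(p−1)`; the last sum is at most `y/N`
trivially (`|L(t)| ≤ t`, `p − 1 ≥ N`, at most `N` primes), and
`∑_{N < p ≤ 2N} 1/(p−1) ≥ #{N < p ≤ 2N : p prime}/(2N) ≥ 1/(4 log N)` by the dyadic prime count of
the tree (`DFI_card_primes_Ioc_ge`, a consequence of the prime number theorem). With `N = ⌊y^θ⌋`
this gives `|L(y)| ≤ 4 log N · (C₁ y N^{−δ₁} + C₂ y^{1−δ₂} + y/N) ≤ K (log y) y^{1−η₀}`,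
`η₀ = min (θ δ₁) (min δ₂ θ)`; the logarithm is absorbed by `log y ≤ y^ε/ε` (`ε = η₀/2`), and
`L(x) = L(⌊x⌋)` passes from natural to real arguments.
-/

noncomputable section

open Finset ArithmeticFunction Filter Asymptotics
open Literature.NumberTheory.LFunctions

namespace Summit.Parity.GeneralizedHardyLittlewood.Theorems.TypeIILiouville

/-- Summing the summands of the remainder over `p ∈ P`:
`(∑_p 1/(p−1)) L(y) = Q − R − ∑_p L(⌊y/p⌋)/(p−1)`. -/
private theorem stubC_identity (P : Finset ℕ) (y : ℕ) :
    (∑ p ∈ P, 1 / ((p : ℝ) - 1)) * (liouvilleSum (y : ℝ) : ℝ) =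
      (∑ p ∈ P, ∑ k ∈ (Icc 1 y).filter (fun k => p ∣ k + 1), (liouville k : ℝ)) -
      (∑ p ∈ P, ((∑ k ∈ (Icc 1 y).filter (fun k => p ∣ k + 1), (liouville k : ℝ)) -
          ((liouvilleSum (y : ℝ) : ℝ) + (liouvilleSum ((y / p : ℕ) : ℝ) : ℝ)) / ((p : ℝ) - 1))) -
      ∑ p ∈ P, (liouvilleSum ((y / p : ℕ) : ℝ) : ℝ) / ((p : ℝ) - 1) := by
  rw [Finset.sum_mul, ← Finset.sum_sub_distrib, ← Finset.sum_sub_distrib]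
  refine Finset.sum_congr rfl fun p _ => ?_
  ring

/-- Real-number bookkeeping: from `S · L = Q − R − T`, `1/M ≤ S` (`M > 0`) and bounds for
`|Q|, |R|, |T|`, the bound `|L| ≤ M (B_Q + B_R + B_T)`. -/
private theorem stubC_abs_le_of_identity {S L Q R T BQ BR BT M : ℝ} (hid : S * L = Q - R - T)
    (hS : 1 / M ≤ S) (hM : 0 < M) (hQ : |Q| ≤ BQ) (hR : |R| ≤ BR) (hT : |T| ≤ BT) :
    |L| ≤ M * (BQ + BR + BT) := by
  have hSpos : 0 < S := lt_of_lt_of_le (by positivity) hS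
  have h1 : S * |L| ≤ BQ + BR + BT := by
    rw [← abs_of_pos hSpos, ← abs_mul, hid]
    calc |Q - R - T| ≤ |Q - R| + |T| := abs_sub _ _
      _ ≤ |Q| + |R| + |T| := by linarith [abs_sub Q R]
      _ ≤ BQ + BR + BT := by linarith
  have h2 : 1 ≤ M * S := by rwa [div_le_iff₀' hM] at hS
  calc |L| = 1 * |L| := (one_mul _).symm
    _ ≤ M * S * |L| := mul_le_mul_of_nonneg_right h2 (abs_nonneg _)
    _ = M * (S * |L|) := by ring
    _ ≤ M * (BQ + BR + BT) := mul_le_mul_of_nonneg_left h1 hM.le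

/-- The trivial bound for the secondary principal terms:
`|∑_{N < p ≤ 2N} L(⌊y/p⌋)/(p−1)| ≤ y/N` (`|L(t)| ≤ t`, `p − 1 ≥ N`, at most `N` primes). -/
private theorem stubC_T_bound (N y : ℕ) (hN : 1 ≤ N) :
    |∑ p ∈ (Ioc N (2 * N)).filter Nat.Prime,
        (liouvilleSum ((y / p : ℕ) : ℝ) : ℝ) / ((p : ℝ) - 1)| ≤ (y : ℝ) / N := by
  have hN0 : (0 : ℝ) < N := by exact_mod_cast hN
  have hN0' : (N : ℝ) ≠ 0 := hN0.ne'
  have hcard : (((Ioc N (2 * N)).filter Nat.Prime).card : ℝ) ≤ N := by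
    have h : ((Ioc N (2 * N)).filter Nat.Prime).card ≤ N :=
      (card_filter_le _ _).trans (by rw [Nat.card_Ioc]; omega)
    exact_mod_cast h
  calc |∑ p ∈ (Ioc N (2 * N)).filter Nat.Prime,
          (liouvilleSum ((y / p : ℕ) : ℝ) : ℝ) / ((p : ℝ) - 1)|
      ≤ ∑ p ∈ (Ioc N (2 * N)).filter Nat.Prime,
          |(liouvilleSum ((y / p : ℕ) : ℝ) : ℝ) / ((p : ℝ) - 1)| := abs_sum_le_sum_abs _ _
    _ ≤ ∑ p ∈ (Ioc N (2 * N)).filter Nat.Prime, (y : ℝ) / N / N := by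
        refine sum_le_sum fun p hp => ?_
        rw [mem_filter, mem_Ioc] at hp
        obtain ⟨⟨hNp, -⟩, -⟩ := hp
        have hp1 : (N : ℝ) ≤ (p : ℝ) - 1 := by
          have h : ((N + 1 : ℕ) : ℝ) ≤ p := by exact_mod_cast Nat.succ_le_of_lt hNp
          push_cast at h
          linarith
        have hp0 : (0 : ℝ) < (p : ℝ) - 1 := lt_of_lt_of_le hN0 hp1
        have hpN : (N : ℝ) ≤ p := by linarith
        rw [abs_div, abs_of_pos hp0]
        have hL : |(liouvilleSum ((y / p : ℕ) : ℝ) : ℝ)| ≤ (y : ℝ) / N :=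
          calc |(liouvilleSum ((y / p : ℕ) : ℝ) : ℝ)| ≤ ((y / p : ℕ) : ℝ) :=
                abs_liouvilleSum_le (Nat.cast_nonneg _)
            _ ≤ (y : ℝ) / p := Nat.cast_div_le
            _ ≤ (y : ℝ) / N := div_le_div_of_nonneg_left (Nat.cast_nonneg _) hN0 hpN
        exact div_le_div₀ (by positivity) hL hN0 hp1
    _ = (((Ioc N (2 * N)).filter Nat.Prime).card : ℝ) * ((y : ℝ) / N / N) := by
        rw [sum_const, nsmul_eq_mul]
    _ ≤ (N : ℝ) * ((y : ℝ) / N / N) := mul_le_mul_of_nonneg_right hcard (by positivity)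
    _ = (y : ℝ) / N := by
        field_simp

/-- Primes in a dyadic window have reciprocal sum `≫ 1/log N`:
`1/(4 log N) ≤ ∑_{N < p ≤ 2N} 1/(p−1)` for `N ≥ N₁` (from `#{N < p ≤ 2N} ≥ N/(2 log N)`,
the tree's `DFI_card_primes_Ioc_ge`). -/
private theorem stubC_S_lower : ∃ N₁ : ℕ, ∀ N : ℕ, N₁ ≤ N →
    1 / (4 * Real.log N) ≤ ∑ p ∈ (Ioc N (2 * N)).filter Nat.Prime, 1 / ((p : ℝ) - 1) := by
  obtain ⟨L₀, hL₀⟩ := Literature.NumberTheory.LFunctions.DFI_card_primes_Ioc_ge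
  refine ⟨max L₀ 2, fun N hN => ?_⟩
  have hNL : L₀ ≤ N := le_of_max_le_left hN
  have hN2 : 2 ≤ N := le_of_max_le_right hN
  have hN1 : (1 : ℝ) < N := by exact_mod_cast (by omega : 1 < N)
  have hN0 : (0 : ℝ) < N := by linarith
  have hlog : 0 < Real.log N := Real.log_pos hN1
  have hlog' : Real.log N ≠ 0 := hlog.ne'
  have hN0' : (N : ℝ) ≠ 0 := hN0.ne'
  have hcard := hL₀ N hNL
  calc 1 / (4 * Real.log N) = (N : ℝ) / (2 * Real.log N) * (1 / (2 * N)) := by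
        field_simp
        ring
    _ ≤ (((Ioc N (2 * N)).filter Nat.Prime).card : ℝ) * (1 / (2 * N)) :=
        mul_le_mul_of_nonneg_right hcard (by positivity)
    _ = ∑ p ∈ (Ioc N (2 * N)).filter Nat.Prime, (1 : ℝ) / (2 * N) := by
        rw [sum_const, nsmul_eq_mul]
    _ ≤ ∑ p ∈ (Ioc N (2 * N)).filter Nat.Prime, 1 / ((p : ℝ) - 1) := by
        refine sum_le_sum fun p hp => ?_
        rw [mem_filter, mem_Ioc] at hp
        obtain ⟨⟨hNp, hp2N⟩, -⟩ := hp
        have hp1 : (N : ℝ) ≤ (p : ℝ) - 1 := by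
          have h : ((N + 1 : ℕ) : ℝ) ≤ p := by exact_mod_cast Nat.succ_le_of_lt hNp
          push_cast at h
          linarith
        have hp0 : (0 : ℝ) < (p : ℝ) - 1 := lt_of_lt_of_le hN0 hp1
        have hp2 : (p : ℝ) - 1 ≤ 2 * N := by
          have h : (p : ℝ) ≤ ((2 * N : ℕ) : ℝ) := by exact_mod_cast hp2N
          push_cast at h
          linarith
        exact one_div_le_one_div_of_le hp0 hp2

/-- The key inequality: for `N ≥ N₁` (`N₁ ≥ 2`) and every `y`, bounds `|Q_N(y)| ≤ B_Q` and
`|R_N(y)| ≤ B_R` give `|L(y)| ≤ 4 log N · (B_Q + B_R + y/N)`. -/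
private theorem stubC_key : ∃ N₁ : ℕ, 2 ≤ N₁ ∧ ∀ N : ℕ, N₁ ≤ N → ∀ y : ℕ, ∀ BQ BR : ℝ,
    |∑ p ∈ (Ioc N (2 * N)).filter Nat.Prime,
        ∑ k ∈ (Icc 1 y).filter (fun k => p ∣ k + 1), (liouville k : ℝ)| ≤ BQ →
    |∑ p ∈ (Ioc N (2 * N)).filter Nat.Prime,
        ((∑ k ∈ (Icc 1 y).filter (fun k => p ∣ k + 1), (liouville k : ℝ)) -
          ((liouvilleSum (y : ℝ) : ℝ) + (liouvilleSum ((y / p : ℕ) : ℝ) : ℝ)) / ((p : ℝ) - 1))| ≤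
      BR →
    |(liouvilleSum (y : ℝ) : ℝ)| ≤ 4 * Real.log N * (BQ + BR + (y : ℝ) / N) := by
  obtain ⟨N₁, hN₁⟩ := stubC_S_lower
  refine ⟨max N₁ 2, le_max_right _ _, fun N hN y BQ BR hQ hR => ?_⟩
  have hNN₁ : N₁ ≤ N := le_of_max_le_left hN
  have hN2 : 2 ≤ N := le_of_max_le_right hN
  have hN1 : (1 : ℝ) < N := by exact_mod_cast (by omega : 1 < N)
  have hlog : 0 < Real.log N := Real.log_pos hN1
  exact stubC_abs_le_of_identity (stubC_identity ((Ioc N (2 * N)).filter Nat.Prime) y)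
    (hN₁ N hNN₁) (by linarith) hQ hR (stubC_T_bound N y (by omega))

/-- The power saving at natural arguments: with `η₀ = min (θ δ₁) (min δ₂ θ)`,
`|L(y)| ≤ C y^{1 − η₀/2}` for `y ≥ y₁` (choice `N = ⌊y^θ⌋`, absorption of `log y`). -/
private theorem stubC_nat_bound {δ₁ C₁ θ δ₂ C₂ : ℝ} {y₀ : ℕ} (hδ₁ : 0 < δ₁) (hθ : 0 < θ)
    (hθ4 : θ ≤ 1 / 4) (hδ₂ : 0 < δ₂)
    (hA : ∀ N : ℕ, 2 ≤ N → ∀ y : ℕ, N ^ 2 ≤ y →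
      |∑ p ∈ (Ioc N (2 * N)).filter Nat.Prime,
          ∑ k ∈ (Icc 1 y).filter (fun k => p ∣ k + 1), (liouville k : ℝ)| ≤
        C₁ * y * (N : ℝ) ^ (-δ₁))
    (hV : ∀ y : ℕ, y₀ ≤ y → ∀ N : ℕ, (y : ℝ) ^ θ / 2 ≤ N → (N : ℝ) ≤ (y : ℝ) ^ θ →
        |∑ p ∈ (Ioc N (2 * N)).filter Nat.Prime,
            ((∑ k ∈ (Icc 1 y).filter (fun k => p ∣ k + 1), (liouville k : ℝ)) -
              ((liouvilleSum (y : ℝ) : ℝ) + (liouvilleSum ((y / p : ℕ) : ℝ) : ℝ)) / ((p : ℝ) - 1))| ≤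
          C₂ * (y : ℝ) ^ (1 - δ₂)) :
    ∃ C : ℝ, 0 ≤ C ∧ ∃ y₁ : ℕ, ∀ y : ℕ, y₁ ≤ y →
      |(liouvilleSum (y : ℝ) : ℝ)| ≤ C * (y : ℝ) ^ (1 - min (θ * δ₁) (min δ₂ θ) / 2) := by
  obtain ⟨N₁, hN₁2, hkey⟩ := stubC_key
  -- the exponents
  set η₀ : ℝ := min (θ * δ₁) (min δ₂ θ) with hη₀
  have hη₀pos : 0 < η₀ := lt_min (mul_pos hθ hδ₁) (lt_min hδ₂ hθ)
  have hη₀a : η₀ ≤ θ * δ₁ := min_le_left _ _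
  have hη₀b : η₀ ≤ δ₂ := (min_le_right _ _).trans (min_le_left _ _)
  have hη₀c : η₀ ≤ θ := (min_le_right _ _).trans (min_le_right _ _)
  set δ : ℝ := η₀ / 2 with hδ
  have hδpos : 0 < δ := by positivity
  -- the constant
  set K : ℝ := |C₁| * (2 : ℝ) ^ δ₁ + |C₂| + 2 with hK
  have hK0 : 0 ≤ K := by positivity
  refine ⟨4 * K / δ, div_nonneg (mul_nonneg (by norm_num) hK0) hδpos.le, ?_⟩
  -- thresholds
  have hev : ∀ᶠ y : ℕ in atTop, y₀ ≤ y ∧ 1 ≤ y ∧ max 2 (N₁ : ℝ) ≤ (y : ℝ) ^ θ :=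
    (eventually_ge_atTop y₀).and ((eventually_ge_atTop 1).and
      (((tendsto_rpow_atTop hθ).comp tendsto_natCast_atTop_atTop).eventually_ge_atTop _))
  obtain ⟨y₁, hy₁⟩ := eventually_atTop.1 hev
  refine ⟨y₁, fun y hy => ?_⟩
  obtain ⟨hyy₀, hy1, hyt⟩ := hy₁ y hy
  -- the parameter `N = ⌊y^θ⌋`
  set t : ℝ := (y : ℝ) ^ θ with ht
  have ht2 : 2 ≤ t := le_trans (le_max_left _ _) hyt
  have hN₁t : (N₁ : ℝ) ≤ t := le_trans (le_max_right _ _) hyt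
  have hy1' : (1 : ℝ) ≤ y := by exact_mod_cast hy1
  have hy0 : (0 : ℝ) < y := by linarith
  have ht0 : 0 ≤ t := Real.rpow_nonneg hy0.le θ
  obtain ⟨N, hNdef⟩ : ∃ N : ℕ, N = ⌊t⌋₊ := ⟨_, rfl⟩
  have hNle : (N : ℝ) ≤ t := by rw [hNdef]; exact Nat.floor_le ht0
  have hNlt : t < N + 1 := by rw [hNdef]; exact Nat.lt_floor_add_one t
  have hNge : t / 2 ≤ N := by linarith
  have hNN₁ : N₁ ≤ N := by rw [hNdef]; exact Nat.le_floor hN₁t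
  have hN2 : 2 ≤ N := hN₁2.trans hNN₁
  have hN0 : (0 : ℝ) < N := by exact_mod_cast (by omega : 0 < N)
  have htley : t ≤ y := by
    rw [ht]
    calc (y : ℝ) ^ θ ≤ (y : ℝ) ^ (1 : ℝ) := Real.rpow_le_rpow_of_exponent_le hy1' (by linarith)
      _ = y := Real.rpow_one _
  -- `N² ≤ y`
  have hNsq : N ^ 2 ≤ y := by
    have h1 : (N : ℝ) ^ 2 ≤ t ^ 2 := pow_le_pow_left₀ hN0.le hNle 2
    have h2 : t ^ 2 = (y : ℝ) ^ (θ * 2) := by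
      rw [ht, Real.rpow_mul hy0.le, Real.rpow_two]
    have h3 : (y : ℝ) ^ (θ * 2) ≤ (y : ℝ) ^ (1 : ℝ) :=
      Real.rpow_le_rpow_of_exponent_le hy1' (by linarith)
    rw [Real.rpow_one] at h3
    have h4 : ((N ^ 2 : ℕ) : ℝ) ≤ (y : ℝ) := by push_cast; linarith
    exact_mod_cast h4
  -- the three inputs
  have hQ := hA N hN2 y hNsq
  have hR := hV y hyy₀ N hNge hNle
  have hL := hkey N hNN₁ y _ _ hQ hR
  -- compare the three bounds with `Y = y^{1-η₀}`
  set Y : ℝ := (y : ℝ) ^ (1 - η₀) with hY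
  have hY0 : 0 ≤ Y := Real.rpow_nonneg hy0.le _
  have hmono : ∀ e : ℝ, η₀ ≤ e → (y : ℝ) ^ (1 - e) ≤ Y := fun e he =>
    Real.rpow_le_rpow_of_exponent_le hy1' (by linarith)
  -- (1) `C₁ y N^{-δ₁} ≤ |C₁| 2^{δ₁} Y`
  have h1 : C₁ * y * (N : ℝ) ^ (-δ₁) ≤ |C₁| * (2 : ℝ) ^ δ₁ * Y := by
    have hNpow : (N : ℝ) ^ (-δ₁) ≤ (2 : ℝ) ^ δ₁ * (y : ℝ) ^ (-(θ * δ₁)) := by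
      have e1 : (t / 2) ^ δ₁ ≤ (N : ℝ) ^ δ₁ := Real.rpow_le_rpow (by positivity) hNge hδ₁.le
      have e2 : (t / 2) ^ δ₁ = (y : ℝ) ^ (θ * δ₁) / (2 : ℝ) ^ δ₁ := by
        rw [Real.div_rpow ht0 (by norm_num), ht, Real.rpow_mul hy0.le]
      have h2pos : (0 : ℝ) < (2 : ℝ) ^ δ₁ := by positivity
      have hypos : (0 : ℝ) < (y : ℝ) ^ (θ * δ₁) := by positivity
      rw [Real.rpow_neg hN0.le, Real.rpow_neg hy0.le]
      rw [e2] at e1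
      calc ((N : ℝ) ^ δ₁)⁻¹ ≤ ((y : ℝ) ^ (θ * δ₁) / (2 : ℝ) ^ δ₁)⁻¹ :=
            inv_anti₀ (by positivity) e1
        _ = (2 : ℝ) ^ δ₁ * ((y : ℝ) ^ (θ * δ₁))⁻¹ := by rw [inv_div, div_eq_mul_inv]
    have e3 : (y : ℝ) * (y : ℝ) ^ (-(θ * δ₁)) = (y : ℝ) ^ (1 - θ * δ₁) := by
      rw [sub_eq_add_neg, Real.rpow_add hy0, Real.rpow_one]
    calc C₁ * y * (N : ℝ) ^ (-δ₁) ≤ |C₁| * y * (N : ℝ) ^ (-δ₁) :=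
          mul_le_mul_of_nonneg_right (mul_le_mul_of_nonneg_right (le_abs_self C₁)
            (Nat.cast_nonneg y)) (Real.rpow_nonneg hN0.le _)
      _ ≤ |C₁| * y * ((2 : ℝ) ^ δ₁ * (y : ℝ) ^ (-(θ * δ₁))) :=
          mul_le_mul_of_nonneg_left hNpow (by positivity)
      _ = |C₁| * (2 : ℝ) ^ δ₁ * ((y : ℝ) * (y : ℝ) ^ (-(θ * δ₁))) := by ring
      _ = |C₁| * (2 : ℝ) ^ δ₁ * (y : ℝ) ^ (1 - θ * δ₁) := by rw [e3]
      _ ≤ |C₁| * (2 : ℝ) ^ δ₁ * Y := mul_le_mul_of_nonneg_left (hmono _ hη₀a) (by positivity)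
  -- (2) `C₂ y^{1-δ₂} ≤ |C₂| Y`
  have h2 : C₂ * (y : ℝ) ^ (1 - δ₂) ≤ |C₂| * Y :=
    calc C₂ * (y : ℝ) ^ (1 - δ₂) ≤ |C₂| * (y : ℝ) ^ (1 - δ₂) :=
          mul_le_mul_of_nonneg_right (le_abs_self C₂) (Real.rpow_nonneg hy0.le _)
      _ ≤ |C₂| * Y := mul_le_mul_of_nonneg_left (hmono _ hη₀b) (abs_nonneg _)
  -- (3) `y/N ≤ 2 Y`
  have h3 : (y : ℝ) / N ≤ 2 * Y := by
    have e1 : (y : ℝ) / N ≤ (y : ℝ) / (t / 2) :=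
      div_le_div_of_nonneg_left hy0.le (by positivity) hNge
    have e2 : (y : ℝ) / (t / 2) = 2 * (y : ℝ) ^ (1 - θ) := by
      rw [Real.rpow_sub hy0, Real.rpow_one, ht]
      ring
    rw [e2] at e1
    exact e1.trans (mul_le_mul_of_nonneg_left (hmono _ hη₀c) (by norm_num))
  -- the logarithm
  have hlogN : Real.log N ≤ (y : ℝ) ^ δ / δ :=
    (Real.log_le_log hN0 (hNle.trans htley)).trans (Real.log_le_rpow_div hy0.le hδpos)
  have hlogN0 : 0 ≤ Real.log N := Real.log_nonneg (by exact_mod_cast (by omega : 1 ≤ N))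
  -- assembly
  have hKY : K * Y = |C₁| * (2 : ℝ) ^ δ₁ * Y + |C₂| * Y + 2 * Y := by rw [hK]; ring
  have hsum : C₁ * y * (N : ℝ) ^ (-δ₁) + C₂ * (y : ℝ) ^ (1 - δ₂) + (y : ℝ) / N ≤ K * Y := by
    rw [hKY]; linarith
  have hexp : (y : ℝ) ^ δ * Y = (y : ℝ) ^ (1 - δ) := by
    rw [hY, ← Real.rpow_add hy0]
    congr 1
    rw [hδ]; ring
  calc |(liouvilleSum (y : ℝ) : ℝ)|
      ≤ 4 * Real.log N * (C₁ * y * (N : ℝ) ^ (-δ₁) + C₂ * (y : ℝ) ^ (1 - δ₂) + (y : ℝ) / N) := hL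
    _ ≤ 4 * Real.log N * (K * Y) := mul_le_mul_of_nonneg_left hsum (by linarith)
    _ ≤ 4 * ((y : ℝ) ^ δ / δ) * (K * Y) :=
        mul_le_mul_of_nonneg_right (mul_le_mul_of_nonneg_left hlogN (by norm_num))
          (mul_nonneg hK0 hY0)
    _ = 4 * K / δ * ((y : ℝ) ^ δ * Y) := by ring
    _ = 4 * K / δ * (y : ℝ) ^ (1 - δ) := by rw [hexp]

/-- From natural to real arguments: `L(x) = L(⌊x⌋)` and `⌊x⌋^{1−δ} ≤ x^{1−δ}` (`δ ≤ 1`, `C ≥ 0`). -/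
private theorem stubC_real_of_nat {δ C : ℝ} {y₁ : ℕ} (hδ : δ ≤ 1) (hC : 0 ≤ C)
    (h : ∀ y : ℕ, y₁ ≤ y → |(liouvilleSum (y : ℝ) : ℝ)| ≤ C * (y : ℝ) ^ (1 - δ)) :
    ∀ x : ℝ, (y₁ : ℝ) ≤ x → |(liouvilleSum x : ℝ)| ≤ C * x ^ (1 - δ) := by
  intro x hx
  have hx0 : 0 ≤ x := le_trans (Nat.cast_nonneg _) hx
  have hy : y₁ ≤ ⌊x⌋₊ := Nat.le_floor hx
  have hfloor : liouvilleSum x = liouvilleSum ((⌊x⌋₊ : ℕ) : ℝ) := by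
    simp only [liouvilleSum, Nat.floor_natCast]
  rw [hfloor]
  refine (h _ hy).trans ?_
  exact mul_le_mul_of_nonneg_left
    (Real.rpow_le_rpow (Nat.cast_nonneg _) (Nat.floor_le hx0) (by linarith)) hC

/-- **Stub C.** From the conclusions of Stubs A and V: `|L(x)| ≤ C x^{1−δ}` for `x ≥ x₀`, some
`0 < δ < 1/2` (identity `(∑_p 1/(p−1)) L(y) = Q_N(y) − R_N(y) − ∑_p L(⌊y/p⌋)/(p−1)`, `N = ⌊y^θ⌋`,
`∑_{N<p≤2N} 1/p ≫ 1/log N`). -/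
theorem stub_C
    (hA : ∃ δ₁ : ℝ, 0 < δ₁ ∧ ∃ C₁ : ℝ, ∀ N : ℕ, 2 ≤ N → ∀ y : ℕ, N ^ 2 ≤ y →
      |∑ p ∈ (Ioc N (2 * N)).filter Nat.Prime,
          ∑ k ∈ (Icc 1 y).filter (fun k => p ∣ k + 1), (liouville k : ℝ)| ≤
        C₁ * y * (N : ℝ) ^ (-δ₁))
    (hV : ∃ θ : ℝ, 0 < θ ∧ θ ≤ 1 / 4 ∧ ∃ δ₂ : ℝ, 0 < δ₂ ∧ ∃ C₂ : ℝ, ∃ y₀ : ℕ, ∀ y : ℕ, y₀ ≤ y →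
      ∀ N : ℕ, (y : ℝ) ^ θ / 2 ≤ N → (N : ℝ) ≤ (y : ℝ) ^ θ →
        |∑ p ∈ (Ioc N (2 * N)).filter Nat.Prime,
            ((∑ k ∈ (Icc 1 y).filter (fun k => p ∣ k + 1), (liouville k : ℝ)) -
              ((liouvilleSum (y : ℝ) : ℝ) + (liouvilleSum ((y / p : ℕ) : ℝ) : ℝ)) / ((p : ℝ) - 1))| ≤
          C₂ * (y : ℝ) ^ (1 - δ₂)) :
    ∃ δ : ℝ, 0 < δ ∧ δ < 1 / 2 ∧ ∃ C x₀ : ℝ, ∀ x : ℝ, x₀ ≤ x →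
      |(liouvilleSum x : ℝ)| ≤ C * x ^ (1 - δ) := by
  obtain ⟨δ₁, hδ₁, C₁, hA'⟩ := hA
  obtain ⟨θ, hθ, hθ4, δ₂, hδ₂, C₂, y₀, hV'⟩ := hV
  obtain ⟨C, hC0, y₁, hy₁⟩ := stubC_nat_bound hδ₁ hθ hθ4 hδ₂ hA' hV'
  have hη₀pos : 0 < min (θ * δ₁) (min δ₂ θ) := lt_min (mul_pos hθ hδ₁) (lt_min hδ₂ hθ)
  have hη₀le : min (θ * δ₁) (min δ₂ θ) ≤ θ := (min_le_right _ _).trans (min_le_right _ _)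
  refine ⟨min (θ * δ₁) (min δ₂ θ) / 2, by positivity, by linarith, C, y₁, ?_⟩
  exact stubC_real_of_nat (by linarith) hC0 hy₁

end Summit.Parity.GeneralizedHardyLittlewood.Theorems.TypeIILiouville

end
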